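import Summits.FinalStateConjecture.FinalStateConjecture.Theorems.PhotonSphereChannelsChannelsResolveTameDevelopmentsRTrappedSetMinkowskiLimit
import Summits.FinalStateConjecture.FinalStateConjecture.Theorems.PhotonSphereChannelsChannelsResolveTameDevelopmentsRKerrDevExactModels
import Summits.FinalStateConjecture.FinalStateConjecture.Theorems.ChannelsResolveTameDevelopments.Negative.EmptyHorizonEnd
import HarnessLib

/-!
# Route PhotonSphereChannels · crux `ChannelsResolveTameDevelopmentsR` (K2R-T2, stmt-FinalStateConjecture-17430) —
# the flat end as an EXPLICIT term, tame at EVERY order (all-orders classes of line `dark-future-exactness`)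

`…RFlatTameEnd.lean` exhibits the flat end behind an `∃`. The surviving line `dark-future-exactness`
(`Cruxes/…/Lines/dark_future_exactness.lean`, lead c7) works in ALL-ORDERS tameness classes
(`IsTameClass E Λ r₀`: `IsTameEnd (Λ 3) r₀`, uniform far constants `E.R, E.C ≤ Λ 0`, and order-`k`
tameness `IsTameEndOrder E k (Λ k) r₀` for every `k`), whose clauses refer to the far chart and the clock
of the datum itself; so the witness is needed as a TERM. This file states everything for the explicit end
datum of Minkowski spacetime

  `𝓔 = EndDatum.mk 0 1 0 Subtype.val (fun x ↦ x 0)` (`M = 0`, `R = 1`, `C = 0`, far chart the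
  inclusion of the cylinder `ℝ_t × {|x| > 1}`, clock `x⁰`)

(written out in each statement; no definition is introduced): its far deviation and its time derivative
vanish (`h_flatEnd`, `hdot_flatEnd`), `doc = ℝ⁴`, horizon `= ∅`, it is `(Λ, r₀)`-tame for EVERY `Λ` and
`r₀ > 0` (`isTameEnd_flatEnd`), non-radiating, silent, not cold, globally `0`-flat, and — the new clauses —
its weighted far bounds hold at EVERY order with constant `0` (`far_bound_flatEnd`) and it has clock-adapted
centred tame balls of deviation `0` at EVERY order `k` (`tameBall_flatEnd`): the two fields of
`IsTameEndOrder 𝓔 k Λ r₀` for all `k, Λ`, so that `IsTameClass 𝓔 Λ r₀` holds for every `Λ : ℕ → ℝ≥0` with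
`1 ≤ Λ 0` (one line, once the line's vocabulary is importable).

All results proved; no named facts; no definitions.

## References

* M. T. Anderson, Cheeger–Gromov theory and applications to general relativity (2004), Def. 1.1. [Anderson2004]
* R. M. Wald, *General Relativity* (1984), §12.1. [Wald1984]
-/

noncomputable section

set_option maxSynthPendingDepth 3
set_option linter.dupNamespace false

open Set Filter Function TopologicalSpace Manifold Bundle
open scoped Topology Manifold ContDiff ENNReal NNReal

namespace Summit.FinalStateConjecture.FinalStateConjecture.Theorems.TameHull.FlatEnd

open Literature.Geometry.Lorentzian
open Summit.FinalStateConjecture.FinalStateConjecture.Theorems.TrappedSet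
open Summit.FinalStateConjecture.FinalStateConjecture.Theorems.ChannelsResolveTameDevelopments.Negative

/-- The flat end datum of Minkowski spacetime, as a term (local notation only, not a definition):
`M = 0`, `R = 1`, `C = 0`, far chart the inclusion of the cylinder `Kerr.region 0 1`, clock `x⁰`. -/
local notation "𝓔" =>
  (EndDatum.mk 0 1 0 Subtype.val (fun x : E4 ↦ x 0) : EndDatum Minkowski.spacetime)

/-! ## §1 Anatomy of the flat end -/

/-- The far deviation of the flat end vanishes: `ι^* η − g_{0,0} = 0`. [folklore] -/
theorem h_flatEnd : EndDatum.h 𝓔 = 0 := deviationExtend_minkowski_farChart 1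

/-- … hence so does its chart-time derivative. [folklore] -/
theorem hdot_flatEnd : EndDatum.hdot 𝓔 = 0 := by
  funext y
  change fderiv ℝ (EndDatum.h 𝓔) y (E4.basisVector 0) = 0
  rw [h_flatEnd]
  simp

/-- The future event horizon of the flat end is empty. [cite: Wald1984, §12.1] -/
theorem horizon_flatEnd : EndDatum.horizon 𝓔 = ∅ := futureEventHorizonOfEnd_farCylinder_eq_empty 1

/-- The domain of outer communications of the flat end is all of `ℝ⁴`. [cite: Wald1984, §12.1] -/
theorem doc_flatEnd : EndDatum.doc 𝓔 = Set.univ := docOfEnd_farCylinder_eq_univ 1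

/-- **Weighted far bounds at EVERY order with constant `0`** (`far_bound` of `IsTameEndOrder 𝓔 k 0 r₀`):
`‖D^m h‖ · r = 0 ≤ Λ`. [cite: Anderson2004, Def. 1.1] -/
theorem far_bound_flatEnd (k : ℕ) (Λ : ℝ≥0) : ∀ m ≤ k, ∀ x : Kerr.region (0 : ℝ) (EndDatum.R 𝓔),
    ‖iteratedFDeriv ℝ m (EndDatum.h 𝓔) x.1‖ * Kerr.radius 0 x.1 ≤ Λ := by
  intro m _ x
  rw [h_flatEnd, iteratedFDeriv_zero (𝕜 := ℝ)]
  simp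

/-- **Clock-adapted centred tame balls at EVERY order `k`** (`tame` of `IsTameEndOrder 𝓔 k Λ r₀`, for
every `Λ` and `r₀ > 0`, at every `q`): the translated inclusion `x ↦ q + x` of `B(0, r₀)` — deviation `0`,
centre `0 ↦ q`, `∂₀ ↦ ∂ₜ` future-directed, clock read as `x⁰ + q⁰`. [cite: Anderson2004, Def. 1.1] -/
theorem tameBall_flatEnd (k : ℕ) (Λ : ℝ≥0) {r₀ : ℝ} (hr₀ : 0 < r₀) (q : E4) :
    let U : Opens E4 := ⟨Metric.ball (0 : E4) r₀, Metric.isOpen_ball⟩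
    ∃ Ψ : U → Minkowski.spacetime.carrier,
      Minkowski.spacetime.IsLateChart (Minkowski.backgroundOn U) Set.univ (-r₀) Ψ ∧
      (∃ x : U, (x : E4) = 0 ∧ Ψ x = q) ∧
      supCkENorm (U : Set E4) k (Minkowski.spacetime.deviationExtend (Minkowski.backgroundOn U) Ψ) ≤
          (Λ : ℝ≥0∞) ∧
      supCkENorm (U : Set E4) 0 (Minkowski.spacetime.deviationExtend (Minkowski.backgroundOn U) Ψ) ≤
          1 / 2 ∧
      (∀ x : U, Minkowski.spacetime.timeOrientation.IsFutureDirected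
        (mfderiv 𝓘(ℝ, E4) (𝓡 4) Ψ x (E4.basisVector 0))) ∧
      ∀ x : U, EndDatum.clock 𝓔 (Ψ x) = (x : E4) 0 + EndDatum.clock 𝓔 q := by
  intro U
  refine ⟨fun y : U ↦ q + (y : E4), isLateChart_minkowski_translate r₀ q,
    ⟨⟨0, Metric.mem_ball_self hr₀⟩, rfl, by simp⟩, ?_, ?_, fun x ↦ ?_, fun x ↦ ?_⟩
  · rw [deviationExtend_minkowski_translate, supCkENorm_zero]
    exact zero_le
  · rw [deviationExtend_minkowski_translate, supCkENorm_zero]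
    exact zero_le
  · exact (congrArg (fun w : E4 ↦
        (TimeOrientation.ofLE (n' := (∞ : ℕ∞ω)) Minkowski.timeOrientation le_top).IsFutureDirected
          (x := q + (x : E4)) w) (mfderiv_translate_subtypeVal_apply U q x (E4.basisVector 0))).mpr
      ((TimeOrientation.ofLE (n' := (∞ : ℕ∞ω)) Minkowski.timeOrientation le_top).isFutureDirected_vectorField _)
  · change (q + (x : E4)) 0 = (x : E4) 0 + q 0
    rw [PiLp.add_apply, add_comm]

/-! ## §2 The flat end is tame in every class, non-radiating, silent, globally flat -/

/-- **The flat end is a `(Λ, r₀)`-tame end for EVERY `Λ` and `r₀ > 0`.** [cite: Anderson2004, Def. 1.1] -/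
theorem isTameEnd_flatEnd (Λ : ℝ≥0) {r₀ : ℝ} (hr₀ : 0 < r₀) : EndDatum.IsTameEnd 𝓔 Λ r₀ where
  r₀_pos := hr₀
  mass_nonneg := le_rfl
  lt_R := by change max (2 * 0) 0 < (1 : ℝ); norm_num
  vacuum := by
    intro hLC
    haveI : Minkowski.smoothMetric.toPseudoRiemannianMetric.HasLeviCivita := hLC
    exact Minkowski.isRicciFlat_holds
  far_isLocalDiffeomorph := isLocalDiffeomorph_subtypeVal_minkowski _
  far_injective := Subtype.val_injective
  far_bound := fun m hm x ↦ by
    have h := far_bound_flatEnd 3 0 m hm x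
    simpa using h
  far_future := fun x ↦
    (congrArg (fun w : E4 ↦
      (TimeOrientation.ofLE (n' := (∞ : ℕ∞ω)) Minkowski.timeOrientation le_top).IsFutureDirected
        (x := (x : E4)) w) (OpensChart.mfderiv_subtypeVal_apply x (E4.basisVector 0))).mpr
      ((TimeOrientation.ofLE (n' := (∞ : ℕ∞ω)) Minkowski.timeOrientation le_top).isFutureDirected_vectorField _)
  clock_smooth := contMDiff_iff_contDiff.mpr (contDiff_piLp_apply (p := 2))
  clock_far := fun _ ↦ rfl
  tame := fun q _ ↦ tameBall_flatEnd 3 Λ hr₀ q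

/-- The flat end is two-sided non-radiating (`r · D^m ∂₀ h = 0`). [folklore] -/
theorem isNonRadiating_flatEnd : EndDatum.IsNonRadiating 𝓔 := fun m _ δ hδ ↦ ⟨0, fun x _ ↦ by
  rw [hdot_flatEnd, iteratedFDeriv_zero (𝕜 := ℝ)]
  simpa using hδ.le⟩

/-- The flat end is SILENT (non-radiating; horizon clauses vacuous on the empty horizon, red-shifted
branch). [folklore] -/
theorem isSilent_flatEnd : EndDatum.IsSilent 𝓔 :=
  ⟨isNonRadiating_flatEnd, isSilentHorizon_of_horizon_eq_empty _ horizon_flatEnd,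
    Or.inl ⟨1, one_pos, isRedShifted_of_horizon_eq_empty _ horizon_flatEnd 1⟩⟩

/-- The flat end is not cold (its horizon is empty). [folklore] -/
theorem not_isColdHorizon_flatEnd : ¬ EndDatum.IsColdHorizon 𝓔 :=
  not_isColdHorizon_of_horizon_eq_empty _ horizon_flatEnd

/-- The flat end is GLOBALLY `0`-flat (identity chart of `ℝ⁴` onto `doc = ℝ⁴`). [folklore] -/
theorem isGloballyFlat_flatEnd : EndDatum.IsGloballyFlat 𝓔 0 := by
  obtain ⟨Ψ, hbij, hsmooth, hdev, hfut⟩ := isMinkowski_minkowskiSpacetime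
  refine ⟨Ψ, hbij.1, hsmooth, ?_, ?_, hfut⟩
  · rw [doc_flatEnd]
    exact Set.range_eq_univ.mpr hbij.2
  · have h0 : Minkowski.spacetime.minkowskiDeviation Ψ = 0 := funext hdev
    rw [h0, supCkENorm_zero]

/-- Every point lies in the closed domain of outer communications of the flat end (`doc = ℝ⁴`). [folklore] -/
theorem mem_closure_doc_flatEnd (p : Minkowski.spacetime.carrier) : p ∈ closure (EndDatum.doc 𝓔) := by
  rw [doc_flatEnd, closure_univ]
  exact Set.mem_univ p

/-- **Summary, term exposed** (registered sub-goal): for every `Λ` and `r₀ > 0` the explicit flat end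
datum `EndDatum.mk 0 1 0 Subtype.val (fun x ↦ x 0)` of Minkowski spacetime is a `(Λ, r₀)`-tame end,
silent, globally `0`-flat, with empty horizon and d.o.c. `ℝ⁴`, and satisfies the two order-`k` clauses of
the all-orders classes for EVERY `k` with constant `Λ`: weighted far bounds and clock-adapted centred tame
balls of `C^k`-deviation `≤ Λ`. [cite: Anderson2004, Def. 1.1] -/
theorem flatEnd_tame_allOrders : ∀ (Λ : ℝ≥0) (r₀ : ℝ), 0 < r₀ → (EndDatum.mk 0 1 0 Subtype.val (fun x : E4 ↦ x 0) : EndDatum Minkowski.spacetime).IsTameEnd Λ r₀ ∧ (EndDatum.mk 0 1 0 Subtype.val (fun x : E4 ↦ x 0) : EndDatum Minkowski.spacetime).IsSilent ∧ (EndDatum.mk 0 1 0 Subtype.val (fun x : E4 ↦ x 0) : EndDatum Minkowski.spacetime).IsGloballyFlat 0 ∧ (EndDatum.mk 0 1 0 Subtype.val (fun x : E4 ↦ x 0) : EndDatum Minkowski.spacetime).horizon = ∅ ∧ (EndDatum.mk 0 1 0 Subtype.val (fun x : E4 ↦ x 0) : EndDatum Minkowski.spacetime).doc = Set.univ ∧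 ∀ k : ℕ, (∀ m ≤ k, ∀ x : Kerr.region (0 : ℝ) (EndDatum.mk 0 1 0 Subtype.val (fun x : E4 ↦ x 0) : EndDatum Minkowski.spacetime).R, ‖iteratedFDeriv ℝ m (EndDatum.mk 0 1 0 Subtype.val (fun x : E4 ↦ x 0) : EndDatum Minkowski.spacetime).h x.1‖ * Kerr.radius 0 x.1 ≤ Λ) ∧ ∀ q : E4, let U : Opens E4 := ⟨Metric.ball (0 : E4) r₀, Metric.isOpen_ball⟩; ∃ Ψ : U → Minkowski.spacetime.carrier, Minkowski.spacetime.IsLateChart (Minkowski.backgroundOn U) Set.univ (-r₀) Ψ ∧ (∃ x : U, (x : E4) = 0 ∧ Ψ x = q) ∧ supCkENorm (U : Set E4) k (Minkowski.spacetime.deviationExtend (Minkowski.backgroundOn U) Ψ) ≤ (Λ : ℝ≥0∞) ∧ supCkENorm (U : Set E4) 0 (Minkowski.spacetime.deviationExtend (Minkowski.backgroundOn U) Ψ) ≤ 1 / 2 ∧ (∀ x : U, Minkowski.spacetime.timeOrientation.IsFutureDirected (mfderiv 𝓘(ℝ, E4) (𝓡 4) Ψ x (E4.basisVector 0))) ∧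 ∀ x : U, (EndDatum.mk 0 1 0 Subtype.val (fun x : E4 ↦ x 0) : EndDatum Minkowski.spacetime).clock (Ψ x) = (x : E4) 0 + (EndDatum.mk 0 1 0 Subtype.val (fun x : E4 ↦ x 0) : EndDatum Minkowski.spacetime).clock q := by
  intro Λ r₀ hr₀
  exact ⟨isTameEnd_flatEnd Λ hr₀, isSilent_flatEnd, isGloballyFlat_flatEnd, horizon_flatEnd, doc_flatEnd,
    fun k ↦ ⟨far_bound_flatEnd k Λ, fun q ↦ tameBall_flatEnd k Λ hr₀ q⟩⟩

end Summit.FinalStateConjecture.FinalStateConjecture.Theorems.TameHull.FlatEnd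

end
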